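import Literature.NumberTheory.EllipticCurves.Sprung2024.ChromaticSmallControlSurjProofs
import Literature.NumberTheory.EllipticCurves.Kobayashi2003.SignedSelmerRankBoundProofs
import Literature.NumberTheory.EllipticCurves.KatoRankBoundProofs
import Mathlib.Algebra.Module.CharacterModule
import Mathlib.LinearAlgebra.Dimension.Torsion.Finite
import HarnessLib

/-!
# Crux K1 `SprungLowerDivisibilityAtThree` (stmt-BirchSwinnertonDyer-19875), line `chromatic-common-zeros`,
# stub S4a (the `(T)`-part at analytic rank `≤ 1`), SELMER SIDE:
# `rank E(K) ≤ rank_{ℤ_p} X^•(E/K_∞)/T X^•(E/K_∞) ≤ ℓ_{(T)} X^•(E/K_∞)` for Sprung's ♯/♭ Selmer groups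
# (`--supports` 19875 as helper; closes nothing by itself)

The ♯/♭ twin of the tree's `Kobayashi2003.SignedSelmerDualData.mordellWeilRank_le_coinvariantsRank`
(`SignedSelmerRankBoundProofs.lean`, Kobayashi's `±`, `a_p = 0`) and of the classical
`WeierstrassCurve.mordellWeilRank_le_coinvariantsRank` (`IwasawaCoinvariantsRankProofs.lean`): Greenberg's
"easy half of control" (LNM 1716, §1 p. 65 with §3 Lemma 3.1) for the Pontryagin dual `X^• = D.X` of
Sprung's chromatic Selmer group `Sel^•(E/K_∞)` (`Sprung2012.sharpFlatSelmerInfty`, Def. 7.11;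
`D : Sprung2012.SharpFlatSelmerDualData`). The ONE new input relative to the `±` file is that the `p^∞`
Kummer map followed by restriction, `E(K) ⊗ ℚ_p/ℤ_p → Sel_{p^∞}(E/K) → H¹(K_∞, E[p^∞])`, LANDS IN
`Sel^•(E/K_∞)`: the classical part as in the tree, and Sprung's `•`-condition at `𝔭 ∣ p` because
`Ker Col^•` kills the bottom layer `E(K_v) = E(K_0·K_v)` — the tree theorem
`Sprung2024.layerToInfty_mem_sharpFlatSelmerInfty_of_mem_selmerLayer_zero` (Sprung 2024 §5.2 p. 39:
`E♯_{0,p} = E♭_{0,p} = E(ℚ_p) ⊗ ℚ_p/ℤ_p`), whose hypothesis `h𝒦` is discharged over `ℚ` with a Honda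
system by `Sprung2012.colemanKer_apply_eq_zero_of_mem_localLayerPointsOfEmb_zero`.

* §1 `resInfty_kummerMapPInfty_mem_sharpFlatSelmerInfty` (`θ^• := res ∘ κ_∞` lands in `Sel^•_∞`, under
  `h𝒦`), `exists_pow_smul_ker_kummerToSharpFlatInfty` (one `p^a` kills `ker θ^•`; Greenberg Lemma 3.1).
* §2 `SharpFlatSelmerDualData.mordellWeilRank_le_coinvariantsRank_of_colemanKer` — **`rank E(K) ≤
  rank_{ℤ_p} X^•/TX^•`** for `X^•` finitely generated over `Λ` (Greenberg's character argument, verbatim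
  the `±` proof); `…_le_lengthAt_primeT_of_colemanKer` — **`rank E(K) ≤ ℓ_{(T)} X^•`**
  (`∘ IwasawaAlgebra.coinvariantsRank_le_lengthAt_primeT`); `…_le_order_of_mem_charIdeal_of_colemanKer`
  — `T^{rank E(K)} ∣ f` for `f ∈ char X^•` (`X^•` torsion).
* §3 over `ℚ` in the binder telescope of the crux (cyclotomic `κ`, place `v ∣ p`, lift `g`, Honda system
  `(cneg, c)`, `p ≠ 2`, `p ∣ a_p`): `h𝒦` discharged — `rat_mordellWeilRank_le_coinvariantsRank`,
  `rat_mordellWeilRank_le_lengthAt_primeT`. This is the Selmer-side input of stub S4a of the lead's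
  split (skeleton cea29801…, 2026-08-28): at `r_an = 1`, `rank E(ℚ) = 1` (GZK) gives `ℓ_{(T)} X^∘ ≥ 1`
  for EVERY colour, to be paired with the analytic side `min(ord_T L♯, ord_T L♭) = 1` (Kobayashi 2013
  Cor. 1.3 (i) ∘ Sprung) and `colour_transfer` (p607724).

No reduction hypothesis beyond the displayed ones; no rank hypothesis; no named fact; no control theorem
(only its easy half is proved here). K1, Sprung's main conjecture and BSD on leaf X8 are NOT proved by
this file.

References: [GreenbergLNM1716] §1 pp. 63, 65, §2 p. 72, §3 Lemma 3.1 (p. 86); [Sprung2012] Def. 7.9, 7.11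
(p. 1503), Def. 7.2 (p. 1500), Thm. 2.2; [Sprung2024] §5.2 p. 39 and Lemma 5.6 (p. 41); [Kobayashi2003]
Def. 1.1, Thm. 9.3; [Washington1997] Thm. 13.12.
-/

set_option autoImplicit false
-- justification: the mandated namespace `Summit.BirchSwinnertonDyer.BirchSwinnertonDyer.Theorems`
-- (single-conjunct summit, Sub = Summit) repeats a segment by design (D-0017).
set_option linter.dupNamespace false

noncomputable section

open CategoryTheory Literature.NumberTheory.EllipticCurves Literature.NumberTheory.GaloisRepresentations
  Literature.NumberTheory.EllipticCurves.ResKernel Literature.NumberTheory.EllipticCurves.IwasawaAlgebra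
  Literature.NumberTheory.EllipticCurves.Sprung2017 Literature.NumberTheory.EllipticCurves.Sprung2012
  Literature.NumberTheory.EllipticCurves.Sprung2024 Literature.NumberTheory.EllipticCurves.Kobayashi2003
  WeierstrassCurve ZpExtension NumberField IsDedekindDomain

open scoped Classical AddSubgroup TensorProduct NumberField

universe u

namespace Summit.BirchSwinnertonDyer.BirchSwinnertonDyer.Theorems.ChromaticCommonZeros

/-! ## §1. `θ^• : E(K) ⊗ ℚ_p/ℤ_p → Sel^•(E/K_∞)` -/

section Theta

variable {K : Type u} [Field K] [NumberField K] (W : WeierstrassCurve K) [W.IsElliptic] {p : ℕ}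
  [Fact p.Prime] (κ : ZpExtension K p) (v : HeightOneSpectrum (𝓞 K))
  (hdiv : W.zsmul_geomPoints_surjective)

/-- **The `p^∞` Kummer map followed by restriction to `K_∞` lands in `Sel^•(E/K_∞)`**, provided
`Ker Col^•` kills the bottom layer `E(K_v) = E(K_0·K_v)` (hypothesis `h𝒦`; over `ℚ` with a Honda system it
is the tree theorem `colemanKer_apply_eq_zero_of_mem_localLayerPointsOfEmb_zero`): the image of
`Sel_{p^∞}(E/K)` in `H¹(K_0, E[p^∞])` lies in `Sel(E/K_0)` (`resOfLe_mem_selmerGroupOver`), whose image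
under `h_0 : H¹(K_0, ·) → H¹(K_∞, ·)` lies in `Sel^•(E/K_∞)`
(`layerToInfty_mem_sharpFlatSelmerInfty_of_mem_selmerLayer_zero`), and `res_{K_∞/K} = h_0 ∘ res_{K_0/K}`.
[cite: Sprung2024, §5.2 p. 39 and Lemma 5.6 (p. 41)] [cite: GreenbergLNM1716, §2 p. 72] -/
theorem resInfty_kummerMapPInfty_mem_sharpFlatSelmerInfty {ap : ℤ}
    {g : Field.absoluteGaloisGroup (v.adicCompletion K)}
    {c : ℕ → localPoints W (v.adicCompletion K)} {col : Chroma}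
    (h𝒦 : ∀ z ∈ colemanKer κ (closureEmb (K := K) (v.adicCompletion K)) W ap g c col,
      ∀ (x : localPoints W (v.adicCompletion K))
        (hx : x ∈ localLayerPointsOfEmb κ (closureEmb (K := K) (v.adicCompletion K)) W 0),
        z ⟨x, localLayerPointsOfEmb_le_localTowerPointsOfEmb κ _ W 0 hx⟩ = 0)
    (t : W.toAffine.Point ⊗[ℤ] PruferQuot p) :
    W.resInfty p κ (W.kummerMapPInfty p hdiv t) ∈
      sharpFlatSelmerInfty W κ (closureEmb (K := K) (v.adicCompletion K)) ap g c col := by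
  set c₁ := W.kummerMapPInfty p hdiv t with hcdef
  have hsel : c₁ ∈ W.selmerGroupPInfty p := by
    refine W.ker_primaryH1ToH1_le_selmerGroupPInfty p ?_
    rw [← W.range_kummerMapPInfty p hdiv]
    exact ⟨t, rfl⟩
  have htop := W.resSubgroup_top_mem_selmerGroupOver hsel
  have h0 : W.resOfLe p (le_top : κ.layerSubgroup 0 ≤ ⊤) (resSubgroup ⊤ (geomPrimaryTorsion W p) c₁) ∈
      W.selmerLayer κ 0 :=
    W.resOfLe_mem_selmerGroupOver p le_top htop
  have heq : W.resInfty p κ c₁ = W.layerToInfty κ 0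
      (W.resOfLe p (le_top : κ.layerSubgroup 0 ≤ ⊤) (resSubgroup ⊤ (geomPrimaryTorsion W p) c₁)) := by
    rw [resInfty_eq_comp, AddMonoidHom.comp_apply, layerToInfty, ← AddMonoidHom.comp_apply
      (W.resOfLe p (κ.kerSubgroup_le_layerSubgroup 0)), W.resOfLe_comp_holds p]
  rw [heq]
  exact layerToInfty_mem_sharpFlatSelmerInfty_of_mem_selmerLayer_zero W κ v h𝒦 h0

variable {κ v}

/-- **`θ^• : E(K) ⊗ ℚ_p/ℤ_p → Sel^•(E/K_∞)` has kernel killed by one power `p^a`** (its kernel is that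
of the tree's `kummerToInfty`: Kummer map injective, `ker res` finite — Greenberg's Lemma 3.1,
`exists_pow_smul_ker_kummerToInfty`). [cite: GreenbergLNM1716, §3 Lemma 3.1] -/
theorem exists_pow_smul_ker_kummerToSharpFlatInfty {ap : ℤ}
    {g : Field.absoluteGaloisGroup (v.adicCompletion K)}
    {c : ℕ → localPoints W (v.adicCompletion K)} {col : Chroma}
    (h𝒦 : ∀ z ∈ colemanKer κ (closureEmb (K := K) (v.adicCompletion K)) W ap g c col,
      ∀ (x : localPoints W (v.adicCompletion K))
        (hx : x ∈ localLayerPointsOfEmb κ (closureEmb (K := K) (v.adicCompletion K)) W 0),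
        z ⟨x, localLayerPointsOfEmb_le_localTowerPointsOfEmb κ _ W 0 hx⟩ = 0)
    {γ : Field.absoluteGaloisGroup K} (hγ : κ.IsTopGenerator γ) :
    ∃ a : ℕ, ∀ t ∈ (((W.resInfty p κ).comp (W.kummerMapPInfty p hdiv)).codRestrict
      (sharpFlatSelmerInfty W κ (closureEmb (K := K) (v.adicCompletion K)) ap g c col)
      (resInfty_kummerMapPInfty_mem_sharpFlatSelmerInfty W κ v hdiv h𝒦)).ker,
      p ^ a • t = 0 := by
  obtain ⟨a, ha⟩ := W.exists_pow_smul_ker_kummerToInfty hdiv hγ (p := p)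
  refine ⟨a, fun t ht => ha t ?_⟩
  rw [AddMonoidHom.mem_ker] at ht ⊢
  apply Subtype.ext
  have h := congrArg (fun s : sharpFlatSelmerInfty W κ (closureEmb (K := K) (v.adicCompletion K))
    ap g c col => (s : W.subgroupH1 p κ.kerSubgroup)) ht
  rw [AddMonoidHom.codRestrict_apply, ZeroMemClass.coe_zero] at h
  rw [coe_kummerToInfty, ZeroMemClass.coe_zero]
  exact h

end Theta

/-! ## §2. `rank E(K) ≤ rank_{ℤ_p} X^•/TX^• ≤ ℓ_{(T)} X^•` -/

section Rank

variable {K : Type u} [Field K] [NumberField K] {W : WeierstrassCurve K} [W.IsElliptic] {p : ℕ}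
  [Fact p.Prime] {κ : ZpExtension K p} {γ : Field.absoluteGaloisGroup K} {v : HeightOneSpectrum (𝓞 K)}
  {ap : ℤ} {g : Field.absoluteGaloisGroup (v.adicCompletion K)}
  {c : ℕ → localPoints W (v.adicCompletion K)} {col : Chroma}

/-- **`rank E(K) ≤ rank_{ℤ_p} X^•(E/K_∞)_Γ`** (divisibility of `E(K̄)` as hypothesis `hdiv`, `Ker Col^•`
kills `E(K_v)` as hypothesis `h𝒦`): for ANY `ℤ_p`-extension `κ` with topological generator `γ`, ANY
colour `•` and ANY Pontryagin-dual datum `D` of `Sel^•(E/K_∞)` with `X^• = D.X` finitely generated over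
`Λ`, `rank E(K) ≤ rank_{ℤ_p} X^•/TX^•`. Proof = the tree's `±` proof verbatim
(`Kobayashi2003.SignedSelmerDualData.mordellWeilRank_le_coinvariantsRank_of`): `r = rank E(K)` characters
`p^a χ_k` of `E(K) ⊗ ℚ_p/ℤ_p` descend along `θ^•`, extend to `Sel^•_∞`, lift to `x_k ∈ X^•`, and have
`ℤ_p`-independent images in `X^•/TX^•` (evaluate a relation at the `γ`-fixed `p^N`-torsion classes
`θ^•(P_i ⊗ [p^{-N}])`). [cite: GreenbergLNM1716, §1 pp. 63, 65 and §3 Lemma 3.1]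
[cite: Sprung2012, Def. 7.11 (p. 1503)] [cite: Sprung2024, §5.2 p. 39] -/
theorem SharpFlatSelmerDualData.mordellWeilRank_le_coinvariantsRank_of_colemanKer
    (hdiv : W.zsmul_geomPoints_surjective) (hγ : κ.IsTopGenerator γ)
    (h𝒦 : ∀ z ∈ colemanKer κ (closureEmb (K := K) (v.adicCompletion K)) W ap g c col,
      ∀ (x : localPoints W (v.adicCompletion K))
        (hx : x ∈ localLayerPointsOfEmb κ (closureEmb (K := K) (v.adicCompletion K)) W 0),
        z ⟨x, localLayerPointsOfEmb_le_localTowerPointsOfEmb κ _ W 0 hx⟩ = 0)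
    (D : SharpFlatSelmerDualData W κ γ (closureEmb (K := K) (v.adicCompletion K)) ap g c col)
    [Module.Finite (IwasawaAlgebra p) D.X] :
    W.mordellWeilRank ≤ coinvariantsRank p D.X := by
  have hp := (Fact.out : p.Prime)
  obtain ⟨P, lam, N₀, hN₀, hlam⟩ := W.exists_points_functionals
  obtain ⟨c₀, hc₀⟩ := exists_character_prufGen p
  let c₀' : PruferQuot p →+ AddCircle (1 : ℚ) := c₀
  have hc₀' : ∀ t, c₀' t = c₀ t := fun _ ↦ rfl
  obtain ⟨a, ha⟩ := exists_pow_smul_ker_kummerToSharpFlatInfty W hdiv h𝒦 hγ (p := p)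
  -- `θ^• = res ∘ κ_∞`, corestricted to `Sel^•_∞`
  set S := sharpFlatSelmerInfty W κ (closureEmb (K := K) (v.adicCompletion K)) ap g c col with hSdef
  let θ : W.toAffine.Point ⊗[ℤ] PruferQuot p →+ S :=
    ((W.resInfty p κ).comp (W.kummerMapPInfty p hdiv)).codRestrict S
      (resInfty_kummerMapPInfty_mem_sharpFlatSelmerInfty W κ v hdiv h𝒦)
  -- the characters `χ_k` of `E(K) ⊗ ℚ_p/ℤ_p`, multiplied by `p^a`
  let χ : Fin (Module.finrank ℤ W.toAffine.Point) →
      (W.toAffine.Point ⊗[ℤ] PruferQuot p →+ AddCircle (1 : ℚ)) :=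
    fun k ↦ (c₀'.toIntLinearMap ∘ₗ (TensorProduct.lid ℤ (PruferQuot p)).toLinearMap ∘ₗ
      ((lam k).rTensor (PruferQuot p))).toAddMonoidHom
  have hχ : ∀ k Q (t : PruferQuot p), χ k (Q ⊗ₜ t) = c₀' (lam k Q • t) := fun k Q t ↦ by
    simp [χ]
  let χ' : Fin (Module.finrank ℤ W.toAffine.Point) →
      (W.toAffine.Point ⊗[ℤ] PruferQuot p →+ AddCircle (1 : ℚ)) :=
    fun k ↦ (nsmulAddMonoidHom (p ^ a)).comp (χ k)
  have hχ' : ∀ k t, χ' k t = p ^ a • χ k t := fun k t ↦ rfl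
  have hker : ∀ k, θ.rangeRestrict.ker ≤ (χ' k).ker := by
    intro k t ht
    rw [AddMonoidHom.mem_ker] at ht ⊢
    have ht' : t ∈ θ.ker := by
      rw [AddMonoidHom.mem_ker]
      exact congrArg (fun z : θ.range ↦ (z : S)) ht
    rw [hχ', ← map_nsmul, ha t ht', map_zero]
  -- descend to `range θ`
  have hsurj : Function.Surjective θ.rangeRestrict := AddMonoidHom.rangeRestrict_surjective θ
  let ψ : Fin (Module.finrank ℤ W.toAffine.Point) → (θ.range →+ AddCircle (1 : ℚ)) := fun k ↦
    θ.rangeRestrict.liftOfSurjective hsurj ⟨χ' k, hker k⟩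
  have hψ : ∀ k t, ψ k (θ.rangeRestrict t) = χ' k t := fun k t ↦
    AddMonoidHom.liftOfRightInverse_comp_apply _ _ _ _ t
  -- extend to characters of `Sel^•_∞` (injectivity of `ℚ/ℤ`)
  have hext : ∀ k, ∃ xt : S →+ AddCircle (1 : ℚ), ∀ g' : θ.range, xt g' = ψ k g' := by
    intro k
    obtain ⟨xt, hxt⟩ := CharacterModule.dual_surjective_of_injective
      (θ.range.subtype.toIntLinearMap) (fun a b h ↦ Subtype.ext h) (ψ k)
    refine ⟨xt, fun g' ↦ ?_⟩
    have := DFunLike.congr_fun hxt g'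
    rw [CharacterModule.dual_apply] at this
    exact this
  choose xt hxt using hext
  -- lift to `X` along `toDual`
  have hX : ∀ k, ∃ x : D.X, D.toDual x = xt k := fun k ↦ D.bijective.2 (xt k)
  choose x hx using hX
  -- values of the characters on the test elements `θ(P_i ⊗ [p^{-N}])`
  have hval : ∀ k i N, xt k (θ (P i ⊗ₜ[ℤ] prufGen p N)) =
      (p ^ a * if k = i then N₀ else 0) • c₀' (prufGen p N) := by
    intro k i N
    have e1 : θ (P i ⊗ₜ[ℤ] prufGen p N) =
        ((θ.rangeRestrict (P i ⊗ₜ[ℤ] prufGen p N) : θ.range) : S) := rfl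
    rw [e1, hxt k, hψ k, hχ', hχ, hlam k i]
    split_ifs with hki
    · rw [map_zsmul, natCast_zsmul, smul_smul]
    · simp
  -- the candidate independent family in `X/TX`
  letI : Module ℤ_[p] (coinvariants p D.X) :=
    Module.compHom _ (algebraMap ℤ_[p] (IwasawaAlgebra p))
  haveI : Module.Finite ℤ_[p] (coinvariants p D.X) := finite_int_coinvariants p D.X
  let y : Fin (Module.finrank ℤ W.toAffine.Point) → coinvariants p D.X :=
    fun k ↦ Submodule.Quotient.mk (x k)
  have hli : LinearIndependent ℤ_[p] y := by
    rw [Fintype.linearIndependent_iff]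
    intro g₁ hg i
    -- `∑ g k • y k = mk (∑ C (g k) • x k)`
    have hsum : (∑ k, g₁ k • y k) = Submodule.Quotient.mk
        (∑ k, (PowerSeries.C (g₁ k) : IwasawaAlgebra p) • x k) := by
      rw [← Submodule.mkQ_apply, map_sum]
      refine Finset.sum_congr rfl fun k _ ↦ ?_
      rw [map_smul, Submodule.mkQ_apply]
      change (algebraMap ℤ_[p] (IwasawaAlgebra p) (g₁ k)) • y k = _
      rw [PowerSeries.algebraMap_eq]
    rw [hsum, Submodule.Quotient.mk_eq_zero, Submodule.ideal_span_singleton_smul,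
      Submodule.mem_smul_pointwise_iff_exists] at hg
    obtain ⟨z, -, hz⟩ := hg
    -- evaluate the characters at the test elements
    have hdvd : ∀ N, p ^ N ∣ (PadicInt.toZModPow N (g₁ i)).val * (p ^ a * N₀) := by
      intro N
      have hsN : p ^ N • θ (P i ⊗ₜ[ℤ] prufGen p N) = 0 := by
        rw [← map_nsmul, ← natCast_zsmul, ← TensorProduct.tmul_smul, zsmul_prufGen_self,
          TensorProduct.tmul_zero, map_zero]
      have hconj : (⟨W.conjH1 p κ.kerSubgroup γ
          (θ (P i ⊗ₜ[ℤ] prufGen p N) : W.subgroupH1 p κ.kerSubgroup),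
          D.conj_mem _ (θ (P i ⊗ₜ[ℤ] prufGen p N)).2⟩ : S) =
            θ (P i ⊗ₜ[ℤ] prufGen p N) :=
        Subtype.ext (W.conjH1_resInfty κ γ _)
      have hC : ∀ (c' : ℤ_[p]) (x' : D.X),
          D.toDual (PowerSeries.C c' • x') (θ (P i ⊗ₜ[ℤ] prufGen p N)) =
            (PadicInt.toZModPow N c').val • D.toDual x' (θ (P i ⊗ₜ[ℤ] prufGen p N)) :=
        fun c' x' ↦ D.toDual_C_smul c' x' _ N hsN
      have h1 := congrArg (fun w ↦ D.toDual w (θ (P i ⊗ₜ[ℤ] prufGen p N))) hz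
      beta_reduce at h1
      rw [D.toDual_T_smul, hconj, sub_self, map_sum, AddMonoidHom.finsetSum_apply] at h1
      simp_rw [hC, hx, hval] at h1
      rw [Finset.sum_eq_single i (fun k _ hk ↦ by simp [hk]) (fun h ↦ (h (Finset.mem_univ i)).elim),
        if_pos rfl, smul_smul, eq_comm] at h1
      have h2 := addOrderOf_dvd_iff_nsmul_eq_zero.mpr h1
      rwa [hc₀', hc₀ N] at h2
    exact padicInt_eq_zero_of_forall_dvd (g₁ i) (mul_ne_zero (pow_ne_zero _ hp.ne_zero) hN₀) hdvd
  -- conclude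
  have hcard := hli.fintype_card_le_finrank
  rw [Fintype.card_fin] at hcard
  have e : coinvariantsRank p D.X = Module.finrank ℤ_[p] (coinvariants p D.X) := by
    show Module.finrank ℚ_[p] (ℚ_[p] ⊗[ℤ_[p]] (coinvariants p D.X)) = _
    exact (TensorProduct.isBaseChange ℤ_[p] (coinvariants p D.X) ℚ_[p]).finrank_eq
  rw [e]
  exact hcard

/-- **`rank E(K) ≤ rank_{ℤ_p} X^•(E/K_∞)_Γ`**, with `hdiv` fed by the tree theorem
`zsmul_geomPoints_surjective_holds`; `Ker Col^•` kills `E(K_v)` as hypothesis `h𝒦`.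
[cite: GreenbergLNM1716, §1 pp. 63, 65 and §3 Lemma 3.1] [cite: Sprung2024, §5.2 p. 39] -/
theorem SharpFlatSelmerDualData.mordellWeilRank_le_coinvariantsRank_of_colemanKer'
    (hγ : κ.IsTopGenerator γ)
    (h𝒦 : ∀ z ∈ colemanKer κ (closureEmb (K := K) (v.adicCompletion K)) W ap g c col,
      ∀ (x : localPoints W (v.adicCompletion K))
        (hx : x ∈ localLayerPointsOfEmb κ (closureEmb (K := K) (v.adicCompletion K)) W 0),
        z ⟨x, localLayerPointsOfEmb_le_localTowerPointsOfEmb κ _ W 0 hx⟩ = 0)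
    (D : SharpFlatSelmerDualData W κ γ (closureEmb (K := K) (v.adicCompletion K)) ap g c col)
    [Module.Finite (IwasawaAlgebra p) D.X] :
    W.mordellWeilRank ≤ coinvariantsRank p D.X :=
  SharpFlatSelmerDualData.mordellWeilRank_le_coinvariantsRank_of_colemanKer
    W.zsmul_geomPoints_surjective_holds hγ h𝒦 D

/-- **`rank E(K) ≤ ℓ_{(T)} X^•(E/K_∞)`** (`X^•` finitely generated over `Λ`; `h𝒦` as above):
`rank E(K) ≤ rank_{ℤ_p} X^•/TX^• ≤ length_{Λ_{(T)}} X^•_{(T)}` (structure theory,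
`IwasawaAlgebra.coinvariantsRank_le_lengthAt_primeT`). In particular a point of infinite order puts
`(T)` in the support of `X^•`. [cite: GreenbergLNM1716, §1 p. 57 and p. 65] [cite: Washington1997, Thm. 13.12] -/
theorem SharpFlatSelmerDualData.mordellWeilRank_le_lengthAt_primeT_of_colemanKer
    (hγ : κ.IsTopGenerator γ)
    (h𝒦 : ∀ z ∈ colemanKer κ (closureEmb (K := K) (v.adicCompletion K)) W ap g c col,
      ∀ (x : localPoints W (v.adicCompletion K))
        (hx : x ∈ localLayerPointsOfEmb κ (closureEmb (K := K) (v.adicCompletion K)) W 0),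
        z ⟨x, localLayerPointsOfEmb_le_localTowerPointsOfEmb κ _ W 0 hx⟩ = 0)
    (D : SharpFlatSelmerDualData W κ γ (closureEmb (K := K) (v.adicCompletion K)) ap g c col)
    [Module.Finite (IwasawaAlgebra p) D.X] :
    (W.mordellWeilRank : ℕ∞) ≤ Module.lengthAt (IwasawaAlgebra p) D.X (primeT p) := by
  have h0 : (W.mordellWeilRank : ℕ∞) ≤ (coinvariantsRank p D.X : ℕ∞) := by
    exact_mod_cast SharpFlatSelmerDualData.mordellWeilRank_le_coinvariantsRank_of_colemanKer' hγ h𝒦 D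
  exact h0.trans (coinvariantsRank_le_lengthAt_primeT (p := p) D.X)

/-- **`rank E(K) ≤ ord_{T=0} f` for every `f ∈ char_Λ X^•(E/K_∞)`** (`X^•` finitely generated
`Λ`-torsion; `h𝒦` as above): `∘ IwasawaAlgebra.coinvariantsRank_le_order_of_mem_charIdeal`. The ♯/♭
analogue of `Kobayashi2003.SignedSelmerDualData.mordellWeilRank_le_order_of_mem_charIdeal`.
[cite: GreenbergLNM1716, §1 pp. 63, 65] [cite: Washington1997, Thm. 13.12] -/
theorem SharpFlatSelmerDualData.mordellWeilRank_le_order_of_mem_charIdeal_of_colemanKer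
    (hγ : κ.IsTopGenerator γ)
    (h𝒦 : ∀ z ∈ colemanKer κ (closureEmb (K := K) (v.adicCompletion K)) W ap g c col,
      ∀ (x : localPoints W (v.adicCompletion K))
        (hx : x ∈ localLayerPointsOfEmb κ (closureEmb (K := K) (v.adicCompletion K)) W 0),
        z ⟨x, localLayerPointsOfEmb_le_localTowerPointsOfEmb κ _ W 0 hx⟩ = 0)
    (D : SharpFlatSelmerDualData W κ γ (closureEmb (K := K) (v.adicCompletion K)) ap g c col)
    [Module.Finite (IwasawaAlgebra p) D.X] (hX : Module.IsTorsion (IwasawaAlgebra p) D.X)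
    {f : IwasawaAlgebra p} (hf : f ∈ D.charIdeal) :
    (W.mordellWeilRank : ℕ∞) ≤ f.order := by
  have h0 : (W.mordellWeilRank : ℕ∞) ≤ (coinvariantsRank p D.X : ℕ∞) := by
    exact_mod_cast SharpFlatSelmerDualData.mordellWeilRank_le_coinvariantsRank_of_colemanKer' hγ h𝒦 D
  exact h0.trans (coinvariantsRank_le_order_of_mem_charIdeal D.X hX f hf)

end Rank

/-! ## §3. Over `ℚ` with a Honda system: `h𝒦` discharged (the binder telescope of the crux) -/

section Rat

variable (W : WeierstrassCurve ℚ) [W.IsElliptic] (p : ℕ) [Fact p.Prime]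

/-- **`rank E(ℚ) ≤ rank_{ℤ_p} X^•(E/ℚ_∞)/TX^•(E/ℚ_∞)`** in the setting of Sprung 2012 Thm. 2.2 / Def. 7.11
— `p ≠ 2`, `p ∣ a_p`, the cyclotomic-type datum `(κ, γ)`, the place `v ∣ p`, a local lift `g` of a
topological generator, a Honda system `(cneg, c)`, either colour `•`, every dual datum `D` of
`Sel^•(E/ℚ_∞)` with `X^•` finitely generated: the `•`-condition on Kummer classes holds because
`Ker Col^•` kills `E(ℚ_p)` (`colemanKer_apply_eq_zero_of_mem_localLayerPointsOfEmb_zero`). No rank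
hypothesis, no control theorem, no `L`-value. [cite: GreenbergLNM1716, §1 p. 65 and §3 Lemma 3.1]
[cite: Sprung2024, §5.2 p. 39] [cite: Sprung2012, Def. 7.2 (p. 1500), Def. 7.11 (p. 1503), Thm. 2.2] -/
theorem rat_mordellWeilRank_le_sharpFlat_coinvariantsRank (hp2 : p ≠ 2) {ap : ℤ}
    (hap : (p : ℤ) ∣ ap) {κ : ZpExtension ℚ p} {γ : Field.absoluteGaloisGroup ℚ}
    (hγ : κ.IsTopGenerator γ) {v : HeightOneSpectrum (𝓞 ℚ)}
    {g : Field.absoluteGaloisGroup (v.adicCompletion ℚ)}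
    (hg : κ.IsTopGenerator (resGalOfEmb (closureEmb (K := ℚ) (v.adicCompletion ℚ)) g))
    {cneg : localPoints W (v.adicCompletion ℚ)} {c : ℕ → localPoints W (v.adicCompletion ℚ)}
    (hH : IsHondaSystem κ (closureEmb (K := ℚ) (v.adicCompletion ℚ)) W ap g cneg c)
    (col : Chroma)
    (D : SharpFlatSelmerDualData W κ γ (closureEmb (K := ℚ) (v.adicCompletion ℚ)) ap g c col)
    [Module.Finite (IwasawaAlgebra p) D.X] :
    W.mordellWeilRank ≤ coinvariantsRank p D.X :=
  SharpFlatSelmerDualData.mordellWeilRank_le_coinvariantsRank_of_colemanKer' hγ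
    (fun _ hz _ hx ↦ colemanKer_apply_eq_zero_of_mem_localLayerPointsOfEmb_zero κ
      (closureEmb (K := ℚ) (v.adicCompletion ℚ)) W hp2 hap hg hH col hz hx) D

/-- **`rank E(ℚ) ≤ ℓ_{(T)} X^•(E/ℚ_∞)`** in the same setting (the Selmer-side input of stub S4a: with
`rank E(ℚ) ≥ 1` — e.g. `r_an = 1` and Gross–Zagier–Kolyvagin — the prime `(T)` carries positive length of
`X^•` for EVERY colour). [cite: GreenbergLNM1716, §1 pp. 57, 65] [cite: Sprung2024, §5.2 p. 39]
[cite: Washington1997, Thm. 13.12] -/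
theorem rat_mordellWeilRank_le_sharpFlat_lengthAt_primeT (hp2 : p ≠ 2) {ap : ℤ}
    (hap : (p : ℤ) ∣ ap) {κ : ZpExtension ℚ p} {γ : Field.absoluteGaloisGroup ℚ}
    (hγ : κ.IsTopGenerator γ) {v : HeightOneSpectrum (𝓞 ℚ)}
    {g : Field.absoluteGaloisGroup (v.adicCompletion ℚ)}
    (hg : κ.IsTopGenerator (resGalOfEmb (closureEmb (K := ℚ) (v.adicCompletion ℚ)) g))
    {cneg : localPoints W (v.adicCompletion ℚ)} {c : ℕ → localPoints W (v.adicCompletion ℚ)}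
    (hH : IsHondaSystem κ (closureEmb (K := ℚ) (v.adicCompletion ℚ)) W ap g cneg c)
    (col : Chroma)
    (D : SharpFlatSelmerDualData W κ γ (closureEmb (K := ℚ) (v.adicCompletion ℚ)) ap g c col)
    [Module.Finite (IwasawaAlgebra p) D.X] :
    (W.mordellWeilRank : ℕ∞) ≤ Module.lengthAt (IwasawaAlgebra p) D.X (primeT p) :=
  SharpFlatSelmerDualData.mordellWeilRank_le_lengthAt_primeT_of_colemanKer hγ
    (fun _ hz _ hx ↦ colemanKer_apply_eq_zero_of_mem_localLayerPointsOfEmb_zero κ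
      (closureEmb (K := ℚ) (v.adicCompletion ℚ)) W hp2 hap hg hH col hz hx) D

end Rat

end Summit.BirchSwinnertonDyer.BirchSwinnertonDyer.Theorems.ChromaticCommonZeros

end
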